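import Mathlib
import HarnessLib
import Summits.NavierStokesRegularity.NavierStokesRegularity.Theorems.HalfSpaceWindowDoorCirculationCarryingRigidityTimeOnlyOutflow

/-!
# Route `HalfSpaceWindowDoor`, crux `CirculationCarryingRigidity` (stmt-NavierStokesRegularity-25311) — THE TIME-ONLY CLASS,
# MASTER FORM: eddy-torque EXCESS over the outflow threshold of size `< Γ/(2(−s))` forces a poloidal profile

Line `eddy_torque` (LEAD ns-hsw-p1 g5).  The two census theorems of the time-only class (`…TimeOnlyOutflow`: `ℛ ≤ (1 + r v̄_r)Γ/r²`;
`…TimeOnlySpinDown`: `ℛ ≤ 0` with `C² < 2`) are the cases `κ = 0` and `κ = C²/4` of one scale-invariant statement, proved here: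

  **Theorem** (`inner_curl_e3_eq_zero_of_excess_lt_half`).  Let `v` be a door-class profile (`‖v(·,t)‖ ≤ C/√(−t)`, continuity,
  the mild identity, divergence-free) with the sign `ω₃ ≥ 0`, and let `0 ≤ κ < 1/2`.  If on every axis circle (`r > 0`, `s < 0`)
  the eddy torque exceeds the outflow threshold by at most `κΓ/(−s)`,
      `ℛ(r,z,s) ≤ (1 + r v̄_r(r,z,s))·Γ(r,z,s)/r² + κ·Γ(r,z,s)/(−s)`,
  then `ω₃ ≡ 0`.

Proof.  By the law of the mean swirl velocity (`…TimeOnlyVEquation.V_law`) the hypothesis says exactly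
`∂ₛV + ⟨v⟩_θ·∇V − ΔV ≤ κV/(−s)` off the axis (`V_ineq_of_excess`, no sign needed); `U = (−s)^κ V` is then a bounded continuous
subsolution with bounded drift on every slab `[s₀,t]` and `sup U(s₀,·) ≤ C(−s₀)^{κ−1/2} → 0` as `s₀ → −∞` iff `κ < 1/2`; the
whole-space maximum principle (`…WholeSpaceMaxPrinciple.le_of_subsolution`) gives `U ≤ 0`, so `V ≡ 0`, `Γ ≡ 0`, poloidal.
The exponent `1/2` is the far-past decay rate of `sup V ≤ C/√(−s)`; it is the exact budget of this method.

All statements concern HYPOTHETICAL blow-up profiles; nothing here is a regularity claim for Navier–Stokes.  The crux itself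
stays open.
-/
set_option linter.dupNamespace false
set_option autoImplicit false

namespace Summit.NavierStokesRegularity.NavierStokesRegularity.Theorems.HalfSpaceWindowDoorCirculationCarryingRigidityTimeOnlyExcess

open Set Filter Topology Function
open scoped Laplacian RealInnerProductSpace ContDiff Classical
open Literature.Analysis Literature.Analysis.FluidPDE
open Summit.NavierStokesRegularity.NavierStokesRegularity.Theorems.AxisTwistDoorAveragedConeLiouvilleDefs
  (cylPt eT e3 circ vortCirc radVortCirc meanR meanZ remainder SignE3)
open Summit.NavierStokesRegularity.NavierStokesRegularity.Theorems.HalfSpaceWindowDoorCirculationCarryingRigidityAxisCirculation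
open Summit.NavierStokesRegularity.NavierStokesRegularity.Theorems.HalfSpaceWindowDoorCirculationCarryingRigidityTimeOnlyVEquation
  (hasDerivAt_V_time V_law)
open Summit.NavierStokesRegularity.NavierStokesRegularity.Theorems.HalfSpaceWindowDoorCirculationCarryingRigidityTimeOnlyOutflow
  (V_le V_nonneg continuousOn_V)
open Summit.NavierStokesRegularity.NavierStokesRegularity.Theorems.HalfSpaceWindowDoorCirculationCarryingRigidityWholeSpaceMaxPrinciple
  (le_of_subsolution)
open Summit.NavierStokesRegularity.NavierStokesRegularity.Theorems.HalfSpaceWindowDoorCirculationCarryingRigidityEddyTorqueOneSidedLiouville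
  (poloidal_of_circF_eq_zero)
open Summit.NavierStokesRegularity.NavierStokesRegularity.Theorems.PoloidalWindowDoorPoloidalWindowRigidityClassSpaceTimeRates
  (exists_fderiv_rate_of_class')
open Summit.NavierStokesRegularity.NavierStokesRegularity.Theorems.PoloidalWindowDoorPoloidalWindowRigidityLargeScaleEnergyBootstrapLevels
  (typeI_const_nonneg)

variable {C : ℝ} {v : ℝ → EuclideanSpace ℝ (Fin 3) → EuclideanSpace ℝ (Fin 3)}

/-! ### The differential inequality for `V` under the excess hypothesis -/

/-- **The excess hypothesis is `∂ₛV + DV[⟨v⟩_θ] − ΔV ≤ κV/(−s)` off the axis** (no sign hypothesis needed). -/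
theorem V_ineq_of_excess {κ : ℝ} (hrate : HasTypeITimeDecay C v)
    (hcont : ContinuousOn (uncurry v) (Iio (0 : ℝ) ×ˢ univ))
    (hmild : ∀ s t : ℝ, s < t → t < 0 → ∀ x,
      v t x = UnboundedOperators.heatExtension (v s) (t - s) x - oseenDuhamel 1 s v v t x)
    (hdiv : ∀ t < 0, VectorCalculus.IsDivFree (v t))
    (hexc : ∀ s < 0, ∀ r : ℝ, 0 < r → ∀ z : ℝ,
      remainder v r z s ≤ (1 + r * meanR v r z s) * circ v r z s / r ^ 2 + κ * circ v r z s / (-s))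
    {σ : ℝ} (hσ : σ < 0) {x : EuclideanSpace ℝ (Fin 3)} (hx : cylRadius x ≠ 0) :
    deriv (fun σ' => (2 * Real.pi)⁻¹ * circ v (cylRadius x) (x 2) σ' / cylRadius x) σ
        + fderiv ℝ (fun y : EuclideanSpace ℝ (Fin 3) => (2 * Real.pi)⁻¹ * circ v (cylRadius y) (y 2) σ / cylRadius y) x
            (angularMeanVec (v σ) x)
        - (Δ (fun y : EuclideanSpace ℝ (Fin 3) => (2 * Real.pi)⁻¹ * circ v (cylRadius y) (y 2) σ / cylRadius y)) x
      ≤ κ / (-σ) * ((2 * Real.pi)⁻¹ * circ v (cylRadius x) (x 2) σ / cylRadius x) := by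
  have hr : 0 < cylRadius x := lt_of_le_of_ne (cylRadius_nonneg x) (Ne.symm hx)
  rw [V_law hrate hcont hmild hdiv hσ hx]
  obtain ⟨Γ, hΓdef⟩ : ∃ Γ, Γ = circ v (cylRadius x) (x 2) σ := ⟨_, rfl⟩
  obtain ⟨R, hRdef⟩ : ∃ R, R = remainder v (cylRadius x) (x 2) σ := ⟨_, rfl⟩
  obtain ⟨mR, hmRdef⟩ : ∃ mR, mR = meanR v (cylRadius x) (x 2) σ := ⟨_, rfl⟩
  obtain ⟨r, hrdef⟩ : ∃ r, r = cylRadius x := ⟨_, rfl⟩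
  rw [← hΓdef, ← hRdef, ← hmRdef, ← hrdef]
  rw [← hrdef] at hr
  have hR : R ≤ (1 + r * mR) * Γ / r ^ 2 + κ * Γ / (-σ) := by
    rw [hRdef, hmRdef, hΓdef, ← hrdef]; exact hexc σ hσ r hr (x 2)
  have h1 : R - mR * Γ / r - Γ / r ^ 2 ≤ κ * Γ / (-σ) := by
    have e : (1 + r * mR) * Γ / r ^ 2 = mR * Γ / r + Γ / r ^ 2 := by
      field_simp
      ring
    linarith [e ▸ hR]
  have hfac : 0 ≤ (2 * Real.pi)⁻¹ * r⁻¹ := by positivity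
  calc (2 * Real.pi)⁻¹ * r⁻¹ * (R - mR * Γ / r - Γ / r ^ 2)
      ≤ (2 * Real.pi)⁻¹ * r⁻¹ * (κ * Γ / (-σ)) := mul_le_mul_of_nonneg_left h1 hfac
    _ = κ / (-σ) * ((2 * Real.pi)⁻¹ * Γ / r) := by ring

/-! ### The weighted maximum principle: `V ≤ 0` when `C² < 2` -/

/-- **`V ≤ 0` under the excess hypothesis, the sign and `κ < 1/2`.**  The weighted quantity `U = (−s)^κ V` is a bounded
continuous subsolution on every slab `[s₀,t]`, `U(s₀,·) ≤ C(−s₀)^κ/√(−s₀) → 0` as `s₀ → −∞`. -/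
theorem V_nonpos_of_excess {κ : ℝ} (hrate : HasTypeITimeDecay C v)
    (hcont : ContinuousOn (uncurry v) (Iio (0 : ℝ) ×ˢ univ))
    (hmild : ∀ s t : ℝ, s < t → t < 0 → ∀ x,
      v t x = UnboundedOperators.heatExtension (v s) (t - s) x - oseenDuhamel 1 s v v t x)
    (hdiv : ∀ t < 0, VectorCalculus.IsDivFree (v t)) (hsign : SignE3 v) (hκ0 : 0 ≤ κ) (hκ : κ < 1 / 2)
    (hexc : ∀ s < 0, ∀ r : ℝ, 0 < r → ∀ z : ℝ,
      remainder v r z s ≤ (1 + r * meanR v r z s) * circ v r z s / r ^ 2 + κ * circ v r z s / (-s))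
    {t : ℝ} (ht : t < 0) (x : EuclideanSpace ℝ (Fin 3)) :
    (2 * Real.pi)⁻¹ * circ v (cylRadius x) (x 2) t / cylRadius x ≤ 0 := by
  have hsm : IsSmoothSpaceTimeOn (Iio (0 : ℝ)) v := isSmoothSpaceTimeOn_of_class hrate hcont hmild hdiv
  have hC := typeI_const_nonneg hrate
  obtain ⟨K, hK0, hK⟩ := exists_fderiv_rate_of_class' hrate hcont hmild
  obtain ⟨a, ha⟩ : ∃ a, a = κ := ⟨_, rfl⟩
  have ha0 : 0 ≤ a := by rw [ha]; exact hκ0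
  -- the weighted maximum principle on `[s₀, t]`
  have hmp : ∀ s₀ < t, (-t) ^ a * ((2 * Real.pi)⁻¹ * circ v (cylRadius x) (x 2) t / cylRadius x) ≤
      (-s₀) ^ a * (C / Real.sqrt (-s₀)) := by
    intro s₀ hs₀
    have hΛ : 0 ≤ C / Real.sqrt (-t) := by positivity
    refine le_of_subsolution (q := fun σ (y : EuclideanSpace ℝ (Fin 3)) =>
        (-σ) ^ a * ((2 * Real.pi)⁻¹ * circ v (cylRadius y) (y 2) σ / cylRadius y))
      (b := fun σ y => angularMeanVec (v σ) y) (B := (-s₀) ^ a * (C / Real.sqrt (-t))) hΛ ?_ ?_ ?_ ?_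
      t (right_mem_Icc.2 hs₀.le) x
    · -- joint continuity
      have hw : Continuous fun p : ℝ × EuclideanSpace ℝ (Fin 3) => (-p.1) ^ a :=
        (Real.continuous_rpow_const ha0).comp (continuous_neg.comp continuous_fst)
      exact hw.continuousOn.mul (continuousOn_V hsm hK0 hK ht)
    · -- the uniform bound on the slab
      intro σ hσ y
      have hσ0 : σ < 0 := lt_of_le_of_lt hσ.2 ht
      have h1 : (-σ) ^ a ≤ (-s₀) ^ a := Real.rpow_le_rpow (by linarith) (by linarith [hσ.1]) ha0
      have h2 : (2 * Real.pi)⁻¹ * circ v (cylRadius y) (y 2) σ / cylRadius y ≤ C / Real.sqrt (-t) :=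
        (V_le hrate hσ0 y).trans
          (div_le_div_of_nonneg_left hC (Real.sqrt_pos.2 (by linarith)) (Real.sqrt_le_sqrt (by linarith [hσ.2])))
      exact mul_le_mul h1 h2 (V_nonneg hsm hsign hσ0 y) (Real.rpow_nonneg (by linarith) _)
    · -- the initial bound
      intro y
      exact mul_le_mul_of_nonneg_left (V_le hrate (by linarith) y) (Real.rpow_nonneg (by linarith) _)
    · -- the subsolution property on `{U > m}`
      intro σ hσ y hmy
      have hσ0 : σ < 0 := lt_of_le_of_lt hσ.2 ht
      have hnσ : 0 < -σ := by linarith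
      have hm0 : 0 ≤ (-s₀) ^ a * (C / Real.sqrt (-s₀)) :=
        mul_nonneg (Real.rpow_nonneg (by linarith) _) (by positivity)
      have hwpos : 0 < (-σ) ^ a := Real.rpow_pos_of_pos hnσ _
      have hVpos : 0 < (2 * Real.pi)⁻¹ * circ v (cylRadius y) (y 2) σ / cylRadius y := by
        by_contra hle
        have : (-σ) ^ a * ((2 * Real.pi)⁻¹ * circ v (cylRadius y) (y 2) σ / cylRadius y) ≤ 0 :=
          mul_nonpos_of_nonneg_of_nonpos hwpos.le (not_lt.1 hle)
        exact absurd (hm0.trans_lt hmy) (not_lt.2 this)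
      have hy : cylRadius y ≠ 0 := by
        intro h0
        rw [h0, div_zero] at hVpos
        exact lt_irrefl _ hVpos
      have hr : 0 < cylRadius y := lt_of_le_of_ne (cylRadius_nonneg y) (Ne.symm hy)
      -- local smoothness of `V(σ,·)` near `y`
      have hF : ContDiff ℝ 2 fun y' : EuclideanSpace ℝ (Fin 3) => (2 * Real.pi)⁻¹ * circ v (cylRadius y') (y' 2) σ :=
        contDiff_circF ((hsm.contDiff_slice hσ0).of_le (by norm_cast))
      have hVU : ContDiffOn ℝ 2 (fun y' : EuclideanSpace ℝ (Fin 3) =>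
          (2 * Real.pi)⁻¹ * circ v (cylRadius y') (y' 2) σ / cylRadius y') {y' | cylRadius y / 2 < cylRadius y'} := by
        refine hF.contDiffOn.div (fun y' hy' => ?_) fun y' hy' => ?_
        · have : cylRadius y / 2 < cylRadius y' := hy'
          exact (contDiffAt_cylRadius (ne_of_gt (by linarith [cylRadius_nonneg y]))).contDiffWithinAt
        · have : cylRadius y / 2 < cylRadius y' := hy'
          exact ne_of_gt (by linarith [cylRadius_nonneg y])
      have hopen : IsOpen {y' : EuclideanSpace ℝ (Fin 3) | cylRadius y / 2 < cylRadius y'} :=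
        isOpen_lt continuous_const continuous_cylRadius
      have hyU : y ∈ {y' : EuclideanSpace ℝ (Fin 3) | cylRadius y / 2 < cylRadius y'} := by
        show cylRadius y / 2 < cylRadius y; linarith
      have hVat : ContDiffAt ℝ 2 (fun y' : EuclideanSpace ℝ (Fin 3) =>
          (2 * Real.pi)⁻¹ * circ v (cylRadius y') (y' 2) σ / cylRadius y') y := hVU.contDiffAt (hopen.mem_nhds hyU)
      have hVd : DifferentiableAt ℝ (fun y' : EuclideanSpace ℝ (Fin 3) =>
          (2 * Real.pi)⁻¹ * circ v (cylRadius y') (y' 2) σ / cylRadius y') y := hVat.differentiableAt (by norm_num)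
      refine ⟨?_, ⟨_, hopen, hyU, contDiffOn_const.mul hVU⟩, ?_⟩
      · have h1 : ‖angularMeanVec (v σ) y‖ ≤ C / Real.sqrt (-σ) :=
          norm_angularMeanVec_le (b := fun _ => C / Real.sqrt (-σ)) (fun x' => hrate σ hσ0 x') y
        exact h1.trans (div_le_div_of_nonneg_left hC (Real.sqrt_pos.2 (by linarith))
          (Real.sqrt_le_sqrt (by linarith [hσ.2])))
      · -- time derivative of `U(·,y)` and the inequality
        have hVt := hasDerivAt_V_time hsm hσ0 y
        have hw : HasDerivAt (fun τ : ℝ => (-τ) ^ a) (-1 * a * (-σ) ^ (a - 1)) σ :=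
          (hasDerivAt_neg σ).rpow_const (Or.inl hnσ.ne')
        refine ⟨_, hw.mul hVt, ?_⟩
        -- `DU[b] = (−σ)^a DV[b]`, `ΔU = (−σ)^a ΔV`
        have hfd : fderiv ℝ (fun y' : EuclideanSpace ℝ (Fin 3) =>
            (-σ) ^ a * ((2 * Real.pi)⁻¹ * circ v (cylRadius y') (y' 2) σ / cylRadius y')) y (angularMeanVec (v σ) y) =
            (-σ) ^ a * fderiv ℝ (fun y' : EuclideanSpace ℝ (Fin 3) =>
              (2 * Real.pi)⁻¹ * circ v (cylRadius y') (y' 2) σ / cylRadius y') y (angularMeanVec (v σ) y) := by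
          rw [fderiv_const_mul hVd, _root_.smul_apply, smul_eq_mul]
        have hlap : (Δ (fun y' : EuclideanSpace ℝ (Fin 3) =>
            (-σ) ^ a * ((2 * Real.pi)⁻¹ * circ v (cylRadius y') (y' 2) σ / cylRadius y'))) y =
            (-σ) ^ a * (Δ (fun y' : EuclideanSpace ℝ (Fin 3) =>
              (2 * Real.pi)⁻¹ * circ v (cylRadius y') (y' 2) σ / cylRadius y')) y := by
          have e : (fun y' : EuclideanSpace ℝ (Fin 3) =>
              (-σ) ^ a * ((2 * Real.pi)⁻¹ * circ v (cylRadius y') (y' 2) σ / cylRadius y')) =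
              (-σ) ^ a • fun y' : EuclideanSpace ℝ (Fin 3) =>
                (2 * Real.pi)⁻¹ * circ v (cylRadius y') (y' 2) σ / cylRadius y' := by
            funext y'; simp [smul_eq_mul]
          rw [e, InnerProductSpace.laplacian_smul _ hVat, smul_eq_mul]
        rw [hfd, hlap]
        have hineq := V_ineq_of_excess hrate hcont hmild hdiv hexc hσ0 hy
        rw [hVt.deriv, ← ha] at hineq
        -- `(−σ)^{a−1} = (−σ)^a/(−σ)`
        have hpow : (-σ) ^ (a - 1) = (-σ) ^ a / (-σ) := Real.rpow_sub_one hnσ.ne' a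
        rw [hpow]
        have hkey : (-σ) ^ a * (a / (-σ) *
            ((2 * Real.pi)⁻¹ * circ v (cylRadius y) (y 2) σ / cylRadius y)) =
            a * ((-σ) ^ a / (-σ)) * ((2 * Real.pi)⁻¹ * circ v (cylRadius y) (y 2) σ / cylRadius y) := by
          field_simp
        nlinarith [mul_le_mul_of_nonneg_left hineq hwpos.le, hkey]
  -- let `s₀ → −∞`: `(−s₀)^a · C/√(−s₀) = C (−s₀)^{a − 1/2} → 0` since `a < 1/2`
  have ha12 : 0 < 1 / 2 - a := by rw [ha]; linarith
  have hlim : Tendsto (fun s₀ : ℝ => (-s₀) ^ a * (C / Real.sqrt (-s₀))) atBot (𝓝 0) := by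
    have h1 : Tendsto (fun u : ℝ => u ^ (-(1 / 2 - a))) atTop (𝓝 0) := tendsto_rpow_neg_atTop ha12
    have h2 := (h1.comp tendsto_neg_atBot_atTop).const_mul C
    rw [mul_zero] at h2
    have hev : (fun s₀ : ℝ => C * (fun u : ℝ => u ^ (-(1 / 2 - a))) (-s₀)) =ᶠ[atBot]
        fun s₀ => (-s₀) ^ a * (C / Real.sqrt (-s₀)) := by
      filter_upwards [eventually_lt_atBot (0 : ℝ)] with s₀ hs₀
      have hn : 0 < -s₀ := by linarith
      show C * (-s₀) ^ (-(1 / 2 - a)) = (-s₀) ^ a * (C / Real.sqrt (-s₀))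
      rw [Real.sqrt_eq_rpow, show -(1 / 2 - a) = a - 1 / 2 by ring, Real.rpow_sub hn]
      field_simp
    exact h2.congr' hev
  have hle : (-t) ^ a * ((2 * Real.pi)⁻¹ * circ v (cylRadius x) (x 2) t / cylRadius x) ≤ 0 :=
    ge_of_tendsto hlim ((eventually_lt_atBot t).mono fun s₀ hs₀ => hmp s₀ hs₀)
  have hwpos : 0 < (-t) ^ a := Real.rpow_pos_of_pos (by linarith) _
  by_contra hpos
  have : 0 < (-t) ^ a * ((2 * Real.pi)⁻¹ * circ v (cylRadius x) (x 2) t / cylRadius x) :=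
    mul_pos hwpos (not_le.1 hpos)
  linarith

/-- **MASTER CENSUS THEOREM OF THE TIME-ONLY CLASS.**  A door-class profile (`‖v(·,t)‖ ≤ C/√(−t)`) with the sign `ω₃ ≥ 0`
whose eddy torque exceeds the outflow threshold by less than half the far-past decay budget,
`ℛ ≤ (1 + r v̄_r)Γ/r² + κΓ/(−s)` on every axis circle with `0 ≤ κ < 1/2`, is POLOIDAL: `ω₃ ≡ 0`.
(`κ = 0`: `…TimeOnlyOutflow`; `ℛ ≤ 0` with `C² < 2` gives the hypothesis with `κ = C²/4`: `…TimeOnlySpinDown`.) -/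
theorem inner_curl_e3_eq_zero_of_excess_lt_half (C κ : ℝ)
    (v : ℝ → EuclideanSpace ℝ (Fin 3) → EuclideanSpace ℝ (Fin 3))
    (hrate : HasTypeITimeDecay C v)
    (hcont : ContinuousOn (uncurry v) (Iio (0 : ℝ) ×ˢ univ))
    (hmild : ∀ s t : ℝ, s < t → t < 0 → ∀ x,
      v t x = UnboundedOperators.heatExtension (v s) (t - s) x - oseenDuhamel 1 s v v t x)
    (hdiv : ∀ t < 0, VectorCalculus.IsDivFree (v t))
    (hκ0 : 0 ≤ κ) (hκ : κ < 1 / 2)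
    (hsign : ∀ s < 0, ∀ y, 0 ≤ inner ℝ (curl (v s) y) (EuclideanSpace.single (2 : Fin 3) (1 : ℝ)))
    (hexc : ∀ s < 0, ∀ r : ℝ, 0 < r → ∀ z : ℝ,
      remainder v r z s ≤ (1 + r * meanR v r z s) * circ v r z s / r ^ 2 + κ * circ v r z s / (-s)) :
    ∀ s < 0, ∀ y, inner ℝ (curl (v s) y) (EuclideanSpace.single (2 : Fin 3) (1 : ℝ)) = 0 := by
  have hsm : IsSmoothSpaceTimeOn (Iio (0 : ℝ)) v := isSmoothSpaceTimeOn_of_class hrate hcont hmild hdiv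
  have hsign' : SignE3 v := hsign
  have hF0 : ∀ t < 0, ∀ x : EuclideanSpace ℝ (Fin 3), (2 * Real.pi)⁻¹ * circ v (cylRadius x) (x 2) t = 0 := by
    intro t ht x
    by_cases hx : cylRadius x = 0
    · exact circF_axis v t hx
    have hV := V_nonpos_of_excess hrate hcont hmild hdiv hsign' hκ0 hκ hexc ht x
    have hV0 := V_nonneg hsm hsign' ht x
    rcases div_eq_zero_iff.1 (le_antisymm hV hV0) with h | h
    · exact h
    · exact absurd h hx
  exact poloidal_of_circF_eq_zero hrate hcont hmild hdiv hsign' hF0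

/-! ### Sharpness of the budget `κ < 1/2` for the engine -/

/-- **The budget `κ < 1/2` is sharp for the engine.**  The space-constant function `q(s,x) = (−s)^{−1/2}` is positive, obeys
the class-type bound `q ≤ 1/√(−s)` (so it decays in the far past exactly like `sup V`), is harmonic in space, and satisfies
`∂ₛq − Δq = q/(2(−s))` EXACTLY: a bounded continuous subsolution at rate `κ = 1/2` with the decay of the class need not
vanish, so no weight `(−s)^κ` with `κ ≥ 1/2` closes the maximum-principle argument (the far-past decay of `sup V` is the whole
budget).  The witness is NOT the mean swirl velocity of a flow; it only bounds the method. -/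
theorem exists_halfBudget_witness :
    ∃ q : ℝ → EuclideanSpace ℝ (Fin 3) → ℝ,
      (∀ s < 0, ∀ x, 0 < q s x) ∧ (∀ s < 0, ∀ x, q s x ≤ 1 / Real.sqrt (-s)) ∧
      (∀ s < 0, ∀ x, HasDerivAt (fun σ => q σ x) ((1 / 2) / (-s) * q s x) s ∧ (Δ (q s)) x = 0) := by
  refine ⟨fun s _ => (-s) ^ (-(1 / 2 : ℝ)), fun s hs x => Real.rpow_pos_of_pos (by linarith) _, fun s hs x => ?_,
    fun s hs x => ⟨?_, ?_⟩⟩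
  · show (-s) ^ (-(1 / 2 : ℝ)) ≤ 1 / Real.sqrt (-s)
    rw [Real.sqrt_eq_rpow, Real.rpow_neg (by linarith), inv_eq_one_div]
  · have hns : 0 < -s := by linarith
    have h := (hasDerivAt_neg s).rpow_const (p := -(1 / 2 : ℝ)) (Or.inl hns.ne')
    have e : -1 * -(1 / 2 : ℝ) * (-s) ^ (-(1 / 2 : ℝ) - 1) = (1 / 2) / (-s) * (-s) ^ (-(1 / 2 : ℝ)) := by
      rw [Real.rpow_sub_one hns.ne']
      field_simp
    rw [e] at h
    exact h
  · show (Δ (fun _ : EuclideanSpace ℝ (Fin 3) => (-s) ^ (-(1 / 2 : ℝ)))) x = 0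
    simp [InnerProductSpace.laplacian_const]

end Summit.NavierStokesRegularity.NavierStokesRegularity.Theorems.HalfSpaceWindowDoorCirculationCarryingRigidityTimeOnlyExcess
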